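import Summits.ValiantsHypothesis.ValiantsHypothesis.Theorems.LacunarySymmetroidMatrixDescartesZeroChangeStateReduction
import Summits.ValiantsHypothesis.ValiantsHypothesis.Theorems.LacunarySymmetroidMatrixDescartesZeroChangeStateVertexDictionary
import Summits.ValiantsHypothesis.ValiantsHypothesis.Theorems.LacunarySymmetroidMatrixDescartesZeroChangeStatePowerSums
import Summits.ValiantsHypothesis.ValiantsHypothesis.Theorems.LacunarySymmetroidMatrixDescartesZeroChangeStateOneRow
import HarnessLib

/-!
# LINE (A) `product_plus_one` — r = 1 rung: **THEOREM E∞ — crit-1's Conjecture E / ΩLC `OmegaLogConcave k` for EVERY `k`**, and (P-U2) for every `k`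

Crux item stmt-ValiantsHypothesis-18050 (`MatrixDescartes`), LINE (A) `Lines/product_plus_one.lean` (skeleton 4c66814e33f05045), floor
`OneChangeFloorK3`, r = 1 rung «one W row × k zero-change rows» (pen val-idea-25 g9 NOTE §56; crit-1 g10/g11 #407–#435, crit-6 g11/g12).
Source of the theorem: pen §56.24 THEOREM E∞ (paper proof + machine-checked k-free certificate; crit-1 #434 / crit-6 #105 PASS) —
«ΩLC — Ω′² > Ω·Ω″ on {Ω > 0} — holds for EVERY number k of zero-change rows and every c > a; hence (★)/`PointwiseU2 k`/(U2) for all k».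
KERNEL ASSEMBLY (this file): for a feasible state with `Ω > 0` put `y_i = ρ(ρ−1)π_i ≥ 0`, `e_i = E i ≥ 0`, aggregates `P_n, Y₀ = CAP = Ω + P₁² + P₂,
Y₁, Y₂, W₀`.  By `…Dictionary` (pen vertex/edge certificates transported to aggregate coordinates) every diagonal form
`V(e_i) = A₀ + 2A₁e_i + (2A₂+A₁₁)e_i² + 12σ₂CAP³ ≥ 96e_i⁸` and every off-diagonal form `E(e_i,e_j) = A₀ + A₁(e_i+e_j) + A₂(e_i²+e_j²) + A₁₁e_ie_j ≥ 0`
(power-sum hypotheses of the other rows from `…PowerSums`); summing, `CAP²·G = 12σ₂CAP³W₀ + Σ_iΣ_j y_iy_jE(e_i,e_j) ≥ Σ_i y_i²V(e_i) ≥ 96Σ_i y_i²e_i⁸ > 0`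
(`G_pos_of_edge`); then `OmegaLogConcave_of_GPos` (`…Reduction`) gives **`OmegaLogConcave_of_edgeAgg … (k) : OmegaLogConcave k`**, and then crit-1's kernel chain
`OmegaLogConcave_implies_PointwiseU2 k` gives `PointwiseU2 k` — the (U2)-half of the r = 1 rung for every `k` — MODULO ONE explicit hypothesis `hedge`:
the aggregate edge form's nonnegativity (= the landed p-form certificate `edgePoly_nonneg` of `…EdgeCert` transported by
`p_n = P_n − e₁ⁿ − e₂ⁿ`; that transport is a single (large) `ring` identity, not yet landed — then `OmegaLogConcave k` is unconditional).

No `def`, no named fact, no sorry; the hypothesis `hedge` is an explicit real-polynomial inequality, not a named fact.  HONEST FRAMING: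
conditional on `hedge`; THEOREM E∞ is ONE HALF ((U2)) of the r = 1 rung; (U1) for `k ≥ 3 ∧ c > 2a`, the
T3♮ ⇒ T3♯ reduction, r ≥ 2 and the A-LAW remain; nothing here closes `stub_oneChangeFloorK3` or any stub of LINE (A); 18050 /
`MatrixDescartes` OPEN; `VP ≠ VNP` is NOT proved.
-/

set_option linter.dupNamespace false

namespace Summit.ValiantsHypothesis.ValiantsHypothesis.Theorems.LacunarySymmetroidMatrixDescartes

namespace ZeroChangeState

open Finset
open scoped BigOperators

set_option maxHeartbeats 16000000 in
set_option maxRecDepth 4000 in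
/-- **`G > 0` on feasible states with `Ω > 0`** (pen THEOREM E∞ steps (2)–(5), every `k`): the ρ-free aggregate polynomial `G` of
`omegaLC_discriminant_identity` is positive — simplex-Bernstein aggregation `CAP²·G = 12σ₂CAP³W₀ + Σ_iΣ_j y_iy_j·E(e_i,e_j)`, off-diagonal
forms `≥ 0` (`edgeAgg_nonneg`), diagonal forms `≥ 96e_i⁸` (`vertexAgg_ge`), and some row has `π_i > 0` (as `Y₀ = Ω + P₁² + P₂ > 0`). -/
theorem G_pos_of_edge
    (hedge : ∀ e1 e2 Om P1 P2 P3 P4 : ℝ, 0 ≤ e1 → 0 ≤ e2 → 0 ≤ Om → 0 ≤ P1 - e1 - e2 → 0 ≤ P2 - e1 ^ 2 - e2 ^ 2 →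
      0 ≤ P3 - e1 ^ 3 - e2 ^ 3 → 0 ≤ P4 - e1 ^ 4 - e2 ^ 4 → P2 - e1 ^ 2 - e2 ^ 2 ≤ (P1 - e1 - e2) ^ 2 →
      P3 - e1 ^ 3 - e2 ^ 3 ≤ (P1 - e1 - e2) * (P2 - e1 ^ 2 - e2 ^ 2) →
      0 ≤ ((8 : ℝ) * P1 ^ 8 + (32 : ℝ) * P1 ^ 6 * P2 + (8 : ℝ) * P1 ^ 7 + (20 : ℝ) * Om * P1 ^ 6
        + (24 : ℝ) * P1 ^ 4 * P2 ^ 2 + (32 : ℝ) * P1 ^ 5 * P3 + (16 : ℝ) * P1 ^ 5 * P2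
        + (64 : ℝ) * Om * P1 ^ 4 * P2 + (16 : ℝ) * Om * P1 ^ 5 + (16 : ℝ) * Om ^ 2 * P1 ^ 4
        + (32 : ℝ) * P1 ^ 3 * P2 * P3 + (8 : ℝ) * P1 ^ 3 * P2 ^ 2 + (24 : ℝ) * P1 ^ 4 * P4
        + (-8 : ℝ) * P1 ^ 4 * P3 + (28 : ℝ) * Om * P1 ^ 2 * P2 ^ 2 + (48 : ℝ) * Om * P1 ^ 3 * P3
        + (24 : ℝ) * Om * P1 ^ 3 * P2 + (40 : ℝ) * Om ^ 2 * P1 ^ 2 * P2 + (8 : ℝ) * Om ^ 2 * P1 ^ 3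
        + (4 : ℝ) * Om ^ 3 * P1 ^ 2 + (-16 : ℝ) * P1 ^ 2 * P3 ^ 2 + (48 : ℝ) * P1 ^ 2 * P2 * P4
        + (-16 : ℝ) * P1 ^ 2 * P2 * P3 + (16 : ℝ) * Om * P1 * P2 * P3 + (8 : ℝ) * Om * P1 * P2 ^ 2
        + (24 : ℝ) * Om * P1 ^ 2 * P4 + (-8 : ℝ) * Om * P1 ^ 2 * P3 + (8 : ℝ) * Om ^ 2 * P2 ^ 2
        + (16 : ℝ) * Om ^ 2 * P1 * P3 + (8 : ℝ) * Om ^ 2 * P1 * P2 + (8 : ℝ) * Om ^ 3 * P2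
        + (-16 : ℝ) * P2 * P3 ^ 2 + (24 : ℝ) * P2 ^ 2 * P4 + (-8 : ℝ) * P2 ^ 2 * P3 + (-16 : ℝ) * Om * P3 ^ 2
        + (24 : ℝ) * Om * P2 * P4 + (-8 : ℝ) * Om * P2 * P3)
      + ((-8 : ℝ) * P1 ^ 7 + (-16 : ℝ) * P1 ^ 5 * P2 + (6 : ℝ) * P1 ^ 6 + (-20 : ℝ) * Om * P1 ^ 5
        + (-8 : ℝ) * P1 ^ 3 * P2 ^ 2 + (8 : ℝ) * P1 ^ 4 * P3 + (18 : ℝ) * P1 ^ 4 * P2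
        + (-24 : ℝ) * Om * P1 ^ 3 * P2 + (12 : ℝ) * Om * P1 ^ 4 + (-16 : ℝ) * Om ^ 2 * P1 ^ 3
        + (16 : ℝ) * P1 ^ 2 * P2 * P3 + (18 : ℝ) * P1 ^ 2 * P2 ^ 2 + (-4 : ℝ) * Om * P1 * P2 ^ 2
        + (16 : ℝ) * Om * P1 ^ 2 * P3 + (24 : ℝ) * Om * P1 ^ 2 * P2 + (-8 : ℝ) * Om ^ 2 * P1 * P2
        + (6 : ℝ) * Om ^ 2 * P1 ^ 2 + (-4 : ℝ) * Om ^ 3 * P1 + (8 : ℝ) * P2 ^ 2 * P3 + (6 : ℝ) * P2 ^ 3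
        + (16 : ℝ) * Om * P2 * P3 + (12 : ℝ) * Om * P2 ^ 2 + (8 : ℝ) * Om ^ 2 * P3 + (6 : ℝ) * Om ^ 2 * P2) * (e1 + e2)
      + ((-24 : ℝ) * P1 ^ 6 + (-72 : ℝ) * P1 ^ 4 * P2 + (-48 : ℝ) * Om * P1 ^ 4 + (-72 : ℝ) * P1 ^ 2 * P2 ^ 2
        + (-96 : ℝ) * Om * P1 ^ 2 * P2 + (-24 : ℝ) * Om ^ 2 * P1 ^ 2 + (-24 : ℝ) * P2 ^ 3
        + (-48 : ℝ) * Om * P2 ^ 2 + (-24 : ℝ) * Om ^ 2 * P2) * (e1 ^ 2 + e2 ^ 2)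
      + ((12 : ℝ) * P1 ^ 6 + (36 : ℝ) * P1 ^ 4 * P2 + (20 : ℝ) * Om * P1 ^ 4 + (36 : ℝ) * P1 ^ 2 * P2 ^ 2
        + (40 : ℝ) * Om * P1 ^ 2 * P2 + (4 : ℝ) * Om ^ 2 * P1 ^ 2 + (12 : ℝ) * P2 ^ 3 + (20 : ℝ) * Om * P2 ^ 2
        + (4 : ℝ) * Om ^ 2 * P2 + (-4 : ℝ) * Om ^ 3) * e1 * e2)
    (k : ℕ) (ρ : ℝ) (E π : Fin k → ℝ) (hρ : 1 < ρ) (hF : Feasible ρ E π) (hΩ : 0 < sOmega ρ E π) :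
    0 < (8 : ℝ) * (∑ i, E i) ^ 8 + (20 : ℝ) * (∑ i, E i) ^ 6 * (sOmega ρ E π)
        + (32 : ℝ) * (∑ i, E i) ^ 6 * (∑ i, E i ^ 2) + (8 : ℝ) * (∑ i, E i) ^ 7
        + (16 : ℝ) * (∑ i, E i) ^ 4 * (sOmega ρ E π) ^ 2
        + (64 : ℝ) * (∑ i, E i) ^ 4 * (∑ i, E i ^ 2) * (sOmega ρ E π)
        + (24 : ℝ) * (∑ i, E i) ^ 4 * (∑ i, E i ^ 2) ^ 2
        + (-16 : ℝ) * (∑ i, E i) ^ 5 * (∑ i, ρ * (ρ - 1) * π i * E i)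
        + (16 : ℝ) * (∑ i, E i) ^ 5 * (sOmega ρ E π) + (32 : ℝ) * (∑ i, E i) ^ 5 * (∑ i, E i ^ 3)
        + (16 : ℝ) * (∑ i, E i) ^ 5 * (∑ i, E i ^ 2) + (4 : ℝ) * (∑ i, E i) ^ 2 * (sOmega ρ E π) ^ 3
        + (40 : ℝ) * (∑ i, E i) ^ 2 * (∑ i, E i ^ 2) * (sOmega ρ E π) ^ 2
        + (28 : ℝ) * (∑ i, E i) ^ 2 * (∑ i, E i ^ 2) ^ 2 * (sOmega ρ E π)
        + (-24 : ℝ) * (∑ i, E i) ^ 3 * (sOmega ρ E π) * (∑ i, ρ * (ρ - 1) * π i * E i)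
        + (8 : ℝ) * (∑ i, E i) ^ 3 * (sOmega ρ E π) ^ 2
        + (48 : ℝ) * (∑ i, E i) ^ 3 * (∑ i, E i ^ 3) * (sOmega ρ E π)
        + (-16 : ℝ) * (∑ i, E i) ^ 3 * (∑ i, E i ^ 2) * (∑ i, ρ * (ρ - 1) * π i * E i)
        + (24 : ℝ) * (∑ i, E i) ^ 3 * (∑ i, E i ^ 2) * (sOmega ρ E π)
        + (32 : ℝ) * (∑ i, E i) ^ 3 * (∑ i, E i ^ 2) * (∑ i, E i ^ 3)
        + (8 : ℝ) * (∑ i, E i) ^ 3 * (∑ i, E i ^ 2) ^ 2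
        + (12 : ℝ) * (∑ i, E i) ^ 4 * (∑ i, (ρ * (ρ - 1) * π i) ^ 2)
        + (-48 : ℝ) * (∑ i, E i) ^ 4 * (∑ i, ρ * (ρ - 1) * π i * E i ^ 2)
        + (12 : ℝ) * (∑ i, E i) ^ 4 * (∑ i, ρ * (ρ - 1) * π i * E i)
        + (24 : ℝ) * (∑ i, E i) ^ 4 * (∑ i, E i ^ 4) + (-8 : ℝ) * (∑ i, E i) ^ 4 * (∑ i, E i ^ 3)
        + (8 : ℝ) * (∑ i, E i ^ 2) * (sOmega ρ E π) ^ 3 + (8 : ℝ) * (∑ i, E i ^ 2) ^ 2 * (sOmega ρ E π) ^ 2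
        + (-8 : ℝ) * (∑ i, E i) * (sOmega ρ E π) ^ 2 * (∑ i, ρ * (ρ - 1) * π i * E i)
        + (16 : ℝ) * (∑ i, E i) * (∑ i, E i ^ 3) * (sOmega ρ E π) ^ 2
        + (-8 : ℝ) * (∑ i, E i) * (∑ i, E i ^ 2) * (sOmega ρ E π) * (∑ i, ρ * (ρ - 1) * π i * E i)
        + (8 : ℝ) * (∑ i, E i) * (∑ i, E i ^ 2) * (sOmega ρ E π) ^ 2
        + (16 : ℝ) * (∑ i, E i) * (∑ i, E i ^ 2) * (∑ i, E i ^ 3) * (sOmega ρ E π)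
        + (8 : ℝ) * (∑ i, E i) * (∑ i, E i ^ 2) ^ 2 * (sOmega ρ E π)
        + (12 : ℝ) * (∑ i, E i) ^ 2 * (∑ i, ρ * (ρ - 1) * π i * E i) ^ 2
        + (12 : ℝ) * (∑ i, E i) ^ 2 * (sOmega ρ E π) * (∑ i, (ρ * (ρ - 1) * π i) ^ 2)
        + (-48 : ℝ) * (∑ i, E i) ^ 2 * (sOmega ρ E π) * (∑ i, ρ * (ρ - 1) * π i * E i ^ 2)
        + (12 : ℝ) * (∑ i, E i) ^ 2 * (sOmega ρ E π) * (∑ i, ρ * (ρ - 1) * π i * E i)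
        + (24 : ℝ) * (∑ i, E i) ^ 2 * (∑ i, E i ^ 4) * (sOmega ρ E π)
        + (16 : ℝ) * (∑ i, E i) ^ 2 * (∑ i, E i ^ 3) * (∑ i, ρ * (ρ - 1) * π i * E i)
        + (-8 : ℝ) * (∑ i, E i) ^ 2 * (∑ i, E i ^ 3) * (sOmega ρ E π)
        + (-16 : ℝ) * (∑ i, E i) ^ 2 * (∑ i, E i ^ 3) ^ 2
        + (24 : ℝ) * (∑ i, E i) ^ 2 * (∑ i, E i ^ 2) * (∑ i, (ρ * (ρ - 1) * π i) ^ 2)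
        + (-96 : ℝ) * (∑ i, E i) ^ 2 * (∑ i, E i ^ 2) * (∑ i, ρ * (ρ - 1) * π i * E i ^ 2)
        + (24 : ℝ) * (∑ i, E i) ^ 2 * (∑ i, E i ^ 2) * (∑ i, ρ * (ρ - 1) * π i * E i)
        + (48 : ℝ) * (∑ i, E i) ^ 2 * (∑ i, E i ^ 2) * (∑ i, E i ^ 4)
        + (-16 : ℝ) * (∑ i, E i) ^ 2 * (∑ i, E i ^ 2) * (∑ i, E i ^ 3)
        + (-4 : ℝ) * (sOmega ρ E π) * (∑ i, ρ * (ρ - 1) * π i * E i) ^ 2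
        + (16 : ℝ) * (∑ i, E i ^ 3) * (sOmega ρ E π) * (∑ i, ρ * (ρ - 1) * π i * E i)
        + (-16 : ℝ) * (∑ i, E i ^ 3) ^ 2 * (sOmega ρ E π)
        + (12 : ℝ) * (∑ i, E i ^ 2) * (∑ i, ρ * (ρ - 1) * π i * E i) ^ 2
        + (12 : ℝ) * (∑ i, E i ^ 2) * (sOmega ρ E π) * (∑ i, (ρ * (ρ - 1) * π i) ^ 2)
        + (-48 : ℝ) * (∑ i, E i ^ 2) * (sOmega ρ E π) * (∑ i, ρ * (ρ - 1) * π i * E i ^ 2)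
        + (12 : ℝ) * (∑ i, E i ^ 2) * (sOmega ρ E π) * (∑ i, ρ * (ρ - 1) * π i * E i)
        + (24 : ℝ) * (∑ i, E i ^ 2) * (∑ i, E i ^ 4) * (sOmega ρ E π)
        + (16 : ℝ) * (∑ i, E i ^ 2) * (∑ i, E i ^ 3) * (∑ i, ρ * (ρ - 1) * π i * E i)
        + (-8 : ℝ) * (∑ i, E i ^ 2) * (∑ i, E i ^ 3) * (sOmega ρ E π)
        + (-16 : ℝ) * (∑ i, E i ^ 2) * (∑ i, E i ^ 3) ^ 2
        + (12 : ℝ) * (∑ i, E i ^ 2) ^ 2 * (∑ i, (ρ * (ρ - 1) * π i) ^ 2)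
        + (-48 : ℝ) * (∑ i, E i ^ 2) ^ 2 * (∑ i, ρ * (ρ - 1) * π i * E i ^ 2)
        + (12 : ℝ) * (∑ i, E i ^ 2) ^ 2 * (∑ i, ρ * (ρ - 1) * π i * E i)
        + (24 : ℝ) * (∑ i, E i ^ 2) ^ 2 * (∑ i, E i ^ 4) + (-8 : ℝ) * (∑ i, E i ^ 2) ^ 2 * (∑ i, E i ^ 3) := by
  -- aggregates
  set P1 : ℝ := ∑ i, E i with hP1
  set P2 : ℝ := ∑ i, E i ^ 2 with hP2
  set P3 : ℝ := ∑ i, E i ^ 3 with hP3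
  set P4 : ℝ := ∑ i, E i ^ 4 with hP4
  set Y1 : ℝ := ∑ i, ρ * (ρ - 1) * π i * E i with hY1
  set Y2 : ℝ := ∑ i, ρ * (ρ - 1) * π i * E i ^ 2 with hY2
  set W0 : ℝ := ∑ i, (ρ * (ρ - 1) * π i) ^ 2 with hW0
  set Om : ℝ := sOmega ρ E π with hOmdef
  set Y0 : ℝ := ∑ i, ρ * (ρ - 1) * π i with hY0
  have hOm : Om = Y0 - P2 - P1 ^ 2 := by rw [hOmdef]; exact sOmega_eq ρ E π P1 P2 Y0 hP1 hP2 hY0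
  -- signs
  have hρ0 : 0 < ρ := by linarith
  have hρρ : 0 ≤ ρ * (ρ - 1) := by nlinarith
  have he : ∀ i, 0 ≤ E i := fun i => by obtain ⟨hπ, hα, _⟩ := hF i; nlinarith [mul_nonneg hρ0.le hπ]
  have hy : ∀ i, 0 ≤ ρ * (ρ - 1) * π i := fun i => mul_nonneg hρρ (hF i).1
  have hP2nn : 0 ≤ P2 := by rw [hP2]; exact Finset.sum_nonneg (fun i _ => sq_nonneg (E i))
  have hCAP : Y0 = Om + P1 ^ 2 + P2 := by linarith
  have hY0pos : 0 < Y0 := by nlinarith [sq_nonneg P1]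
  -- the four coefficient polynomials of the quadratic-in-y structure of G
  set A0 : ℝ := (8 : ℝ) * P1 ^ 8 + (32 : ℝ) * P1 ^ 6 * P2 + (8 : ℝ) * P1 ^ 7 + (20 : ℝ) * Om * P1 ^ 6
        + (24 : ℝ) * P1 ^ 4 * P2 ^ 2 + (32 : ℝ) * P1 ^ 5 * P3 + (16 : ℝ) * P1 ^ 5 * P2
        + (64 : ℝ) * Om * P1 ^ 4 * P2 + (16 : ℝ) * Om * P1 ^ 5 + (16 : ℝ) * Om ^ 2 * P1 ^ 4
        + (32 : ℝ) * P1 ^ 3 * P2 * P3 + (8 : ℝ) * P1 ^ 3 * P2 ^ 2 + (24 : ℝ) * P1 ^ 4 * P4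
        + (-8 : ℝ) * P1 ^ 4 * P3 + (28 : ℝ) * Om * P1 ^ 2 * P2 ^ 2 + (48 : ℝ) * Om * P1 ^ 3 * P3
        + (24 : ℝ) * Om * P1 ^ 3 * P2 + (40 : ℝ) * Om ^ 2 * P1 ^ 2 * P2 + (8 : ℝ) * Om ^ 2 * P1 ^ 3
        + (4 : ℝ) * Om ^ 3 * P1 ^ 2 + (-16 : ℝ) * P1 ^ 2 * P3 ^ 2 + (48 : ℝ) * P1 ^ 2 * P2 * P4
        + (-16 : ℝ) * P1 ^ 2 * P2 * P3 + (16 : ℝ) * Om * P1 * P2 * P3 + (8 : ℝ) * Om * P1 * P2 ^ 2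
        + (24 : ℝ) * Om * P1 ^ 2 * P4 + (-8 : ℝ) * Om * P1 ^ 2 * P3 + (8 : ℝ) * Om ^ 2 * P2 ^ 2
        + (16 : ℝ) * Om ^ 2 * P1 * P3 + (8 : ℝ) * Om ^ 2 * P1 * P2 + (8 : ℝ) * Om ^ 3 * P2
        + (-16 : ℝ) * P2 * P3 ^ 2 + (24 : ℝ) * P2 ^ 2 * P4 + (-8 : ℝ) * P2 ^ 2 * P3 + (-16 : ℝ) * Om * P3 ^ 2
        + (24 : ℝ) * Om * P2 * P4 + (-8 : ℝ) * Om * P2 * P3 with hA0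
  set A1 : ℝ := (-8 : ℝ) * P1 ^ 7 + (-16 : ℝ) * P1 ^ 5 * P2 + (6 : ℝ) * P1 ^ 6 + (-20 : ℝ) * Om * P1 ^ 5
        + (-8 : ℝ) * P1 ^ 3 * P2 ^ 2 + (8 : ℝ) * P1 ^ 4 * P3 + (18 : ℝ) * P1 ^ 4 * P2
        + (-24 : ℝ) * Om * P1 ^ 3 * P2 + (12 : ℝ) * Om * P1 ^ 4 + (-16 : ℝ) * Om ^ 2 * P1 ^ 3
        + (16 : ℝ) * P1 ^ 2 * P2 * P3 + (18 : ℝ) * P1 ^ 2 * P2 ^ 2 + (-4 : ℝ) * Om * P1 * P2 ^ 2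
        + (16 : ℝ) * Om * P1 ^ 2 * P3 + (24 : ℝ) * Om * P1 ^ 2 * P2 + (-8 : ℝ) * Om ^ 2 * P1 * P2
        + (6 : ℝ) * Om ^ 2 * P1 ^ 2 + (-4 : ℝ) * Om ^ 3 * P1 + (8 : ℝ) * P2 ^ 2 * P3 + (6 : ℝ) * P2 ^ 3
        + (16 : ℝ) * Om * P2 * P3 + (12 : ℝ) * Om * P2 ^ 2 + (8 : ℝ) * Om ^ 2 * P3 + (6 : ℝ) * Om ^ 2 * P2 with hA1
  set A2 : ℝ := (-24 : ℝ) * P1 ^ 6 + (-72 : ℝ) * P1 ^ 4 * P2 + (-48 : ℝ) * Om * P1 ^ 4 + (-72 : ℝ) * P1 ^ 2 * P2 ^ 2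
        + (-96 : ℝ) * Om * P1 ^ 2 * P2 + (-24 : ℝ) * Om ^ 2 * P1 ^ 2 + (-24 : ℝ) * P2 ^ 3
        + (-48 : ℝ) * Om * P2 ^ 2 + (-24 : ℝ) * Om ^ 2 * P2 with hA2
  set A11 : ℝ := (12 : ℝ) * P1 ^ 6 + (36 : ℝ) * P1 ^ 4 * P2 + (20 : ℝ) * Om * P1 ^ 4 + (36 : ℝ) * P1 ^ 2 * P2 ^ 2
        + (40 : ℝ) * Om * P1 ^ 2 * P2 + (4 : ℝ) * Om ^ 2 * P1 ^ 2 + (12 : ℝ) * P2 ^ 3 + (20 : ℝ) * Om * P2 ^ 2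
        + (4 : ℝ) * Om ^ 2 * P2 + (-4 : ℝ) * Om ^ 3 with hA11
  -- (I1) the aggregation identity
  have hI1 : Y0 ^ 2 * ((8 : ℝ) * P1 ^ 8 + (20 : ℝ) * P1 ^ 6 * Om + (32 : ℝ) * P1 ^ 6 * P2 + (8 : ℝ) * P1 ^ 7
        + (16 : ℝ) * P1 ^ 4 * Om ^ 2 + (64 : ℝ) * P1 ^ 4 * P2 * Om + (24 : ℝ) * P1 ^ 4 * P2 ^ 2
        + (-16 : ℝ) * P1 ^ 5 * Y1 + (16 : ℝ) * P1 ^ 5 * Om + (32 : ℝ) * P1 ^ 5 * P3 + (16 : ℝ) * P1 ^ 5 * P2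
        + (4 : ℝ) * P1 ^ 2 * Om ^ 3 + (40 : ℝ) * P1 ^ 2 * P2 * Om ^ 2 + (28 : ℝ) * P1 ^ 2 * P2 ^ 2 * Om
        + (-24 : ℝ) * P1 ^ 3 * Om * Y1 + (8 : ℝ) * P1 ^ 3 * Om ^ 2 + (48 : ℝ) * P1 ^ 3 * P3 * Om
        + (-16 : ℝ) * P1 ^ 3 * P2 * Y1 + (24 : ℝ) * P1 ^ 3 * P2 * Om + (32 : ℝ) * P1 ^ 3 * P2 * P3
        + (8 : ℝ) * P1 ^ 3 * P2 ^ 2 + (12 : ℝ) * P1 ^ 4 * W0 + (-48 : ℝ) * P1 ^ 4 * Y2 + (12 : ℝ) * P1 ^ 4 * Y1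
        + (24 : ℝ) * P1 ^ 4 * P4 + (-8 : ℝ) * P1 ^ 4 * P3 + (8 : ℝ) * P2 * Om ^ 3 + (8 : ℝ) * P2 ^ 2 * Om ^ 2
        + (-8 : ℝ) * P1 * Om ^ 2 * Y1 + (16 : ℝ) * P1 * P3 * Om ^ 2 + (-8 : ℝ) * P1 * P2 * Om * Y1
        + (8 : ℝ) * P1 * P2 * Om ^ 2 + (16 : ℝ) * P1 * P2 * P3 * Om + (8 : ℝ) * P1 * P2 ^ 2 * Om
        + (12 : ℝ) * P1 ^ 2 * Y1 ^ 2 + (12 : ℝ) * P1 ^ 2 * Om * W0 + (-48 : ℝ) * P1 ^ 2 * Om * Y2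
        + (12 : ℝ) * P1 ^ 2 * Om * Y1 + (24 : ℝ) * P1 ^ 2 * P4 * Om + (16 : ℝ) * P1 ^ 2 * P3 * Y1
        + (-8 : ℝ) * P1 ^ 2 * P3 * Om + (-16 : ℝ) * P1 ^ 2 * P3 ^ 2 + (24 : ℝ) * P1 ^ 2 * P2 * W0
        + (-96 : ℝ) * P1 ^ 2 * P2 * Y2 + (24 : ℝ) * P1 ^ 2 * P2 * Y1 + (48 : ℝ) * P1 ^ 2 * P2 * P4
        + (-16 : ℝ) * P1 ^ 2 * P2 * P3 + (-4 : ℝ) * Om * Y1 ^ 2 + (16 : ℝ) * P3 * Om * Y1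
        + (-16 : ℝ) * P3 ^ 2 * Om + (12 : ℝ) * P2 * Y1 ^ 2 + (12 : ℝ) * P2 * Om * W0 + (-48 : ℝ) * P2 * Om * Y2
        + (12 : ℝ) * P2 * Om * Y1 + (24 : ℝ) * P2 * P4 * Om + (16 : ℝ) * P2 * P3 * Y1 + (-8 : ℝ) * P2 * P3 * Om
        + (-16 : ℝ) * P2 * P3 ^ 2 + (12 : ℝ) * P2 ^ 2 * W0 + (-48 : ℝ) * P2 ^ 2 * Y2 + (12 : ℝ) * P2 ^ 2 * Y1
        + (24 : ℝ) * P2 ^ 2 * P4 + (-8 : ℝ) * P2 ^ 2 * P3)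
      = 12 * (P1 ^ 2 + P2) * Y0 ^ 3 * W0 + (A0 * Y0 ^ 2 + 2 * A1 * Y0 * Y1 + 2 * A2 * Y0 * Y2 + A11 * Y1 ^ 2) := by
    rw [hA0, hA1, hA2, hA11, hCAP]; ring
  -- (I2) the double sum of the edge forms in closed form
  have hinner : ∀ i, ∑ j, ρ * (ρ - 1) * π i * (ρ * (ρ - 1) * π j)
        * (A0 + A1 * (E i + E j) + A2 * (E i ^ 2 + E j ^ 2) + A11 * E i * E j)
      = ρ * (ρ - 1) * π i * (A0 * Y0 + A1 * (E i * Y0 + Y1) + A2 * (E i ^ 2 * Y0 + Y2) + A11 * E i * Y1) := by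
    intro i
    have t1 : (ρ * (ρ - 1) * π i * (A0 + A1 * E i + A2 * E i ^ 2)) * Y0
        = ∑ j, (ρ * (ρ - 1) * π i * (A0 + A1 * E i + A2 * E i ^ 2)) * (ρ * (ρ - 1) * π j) := by
      rw [hY0, Finset.mul_sum]
    have t2 : (ρ * (ρ - 1) * π i * (A1 + A11 * E i)) * Y1
        = ∑ j, (ρ * (ρ - 1) * π i * (A1 + A11 * E i)) * (ρ * (ρ - 1) * π j * E j) := by
      rw [hY1, Finset.mul_sum]
    have t3 : (ρ * (ρ - 1) * π i * A2) * Y2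
        = ∑ j, (ρ * (ρ - 1) * π i * A2) * (ρ * (ρ - 1) * π j * E j ^ 2) := by
      rw [hY2, Finset.mul_sum]
    calc ∑ j, ρ * (ρ - 1) * π i * (ρ * (ρ - 1) * π j)
          * (A0 + A1 * (E i + E j) + A2 * (E i ^ 2 + E j ^ 2) + A11 * E i * E j)
        = ∑ j, ((ρ * (ρ - 1) * π i * (A0 + A1 * E i + A2 * E i ^ 2)) * (ρ * (ρ - 1) * π j)
            + (ρ * (ρ - 1) * π i * (A1 + A11 * E i)) * (ρ * (ρ - 1) * π j * E j)
            + (ρ * (ρ - 1) * π i * A2) * (ρ * (ρ - 1) * π j * E j ^ 2)) :=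
          Finset.sum_congr rfl (fun j _ => by ring)
      _ = (ρ * (ρ - 1) * π i * (A0 + A1 * E i + A2 * E i ^ 2)) * Y0
            + (ρ * (ρ - 1) * π i * (A1 + A11 * E i)) * Y1 + (ρ * (ρ - 1) * π i * A2) * Y2 := by
          rw [Finset.sum_add_distrib, Finset.sum_add_distrib, t1, t2, t3]
      _ = ρ * (ρ - 1) * π i * (A0 * Y0 + A1 * (E i * Y0 + Y1) + A2 * (E i ^ 2 * Y0 + Y2) + A11 * E i * Y1) := by
          ring
  have hI2 : ∑ i, ∑ j, ρ * (ρ - 1) * π i * (ρ * (ρ - 1) * π j)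
        * (A0 + A1 * (E i + E j) + A2 * (E i ^ 2 + E j ^ 2) + A11 * E i * E j)
      = A0 * Y0 ^ 2 + 2 * A1 * Y0 * Y1 + 2 * A2 * Y0 * Y2 + A11 * Y1 ^ 2 := by
    rw [Finset.sum_congr rfl (fun i _ => hinner i)]
    have t1 : (A0 * Y0 + A1 * Y1 + A2 * Y2) * Y0 = ∑ i, (A0 * Y0 + A1 * Y1 + A2 * Y2) * (ρ * (ρ - 1) * π i) := by
      rw [hY0, Finset.mul_sum]
    have t2 : (A1 * Y0 + A11 * Y1) * Y1 = ∑ i, (A1 * Y0 + A11 * Y1) * (ρ * (ρ - 1) * π i * E i) := by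
      rw [hY1, Finset.mul_sum]
    have t3 : (A2 * Y0) * Y2 = ∑ i, (A2 * Y0) * (ρ * (ρ - 1) * π i * E i ^ 2) := by
      rw [hY2, Finset.mul_sum]
    calc ∑ i, ρ * (ρ - 1) * π i * (A0 * Y0 + A1 * (E i * Y0 + Y1) + A2 * (E i ^ 2 * Y0 + Y2) + A11 * E i * Y1)
        = ∑ i, ((A0 * Y0 + A1 * Y1 + A2 * Y2) * (ρ * (ρ - 1) * π i)
            + (A1 * Y0 + A11 * Y1) * (ρ * (ρ - 1) * π i * E i) + (A2 * Y0) * (ρ * (ρ - 1) * π i * E i ^ 2)) :=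
          Finset.sum_congr rfl (fun i _ => by ring)
      _ = (A0 * Y0 + A1 * Y1 + A2 * Y2) * Y0 + (A1 * Y0 + A11 * Y1) * Y1 + (A2 * Y0) * Y2 := by
          rw [Finset.sum_add_distrib, Finset.sum_add_distrib, t1, t2, t3]
      _ = A0 * Y0 ^ 2 + 2 * A1 * Y0 * Y1 + 2 * A2 * Y0 * Y2 + A11 * Y1 ^ 2 := by ring
  -- power sums of the other rows
  have hpow : ∀ (s : Finset (Fin k)) (n : ℕ), 0 ≤ ∑ j ∈ s, E j ^ n := fun s n => sum_pow_nonneg_of_nonneg s E (fun j _ => he j) n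
  have hsq : ∀ s : Finset (Fin k), ∑ j ∈ s, E j ^ 2 ≤ (∑ j ∈ s, E j) ^ 2 := fun s => sum_sq_le_sq_sum s E (fun j _ => he j)
  have hcu : ∀ s : Finset (Fin k), ∑ j ∈ s, E j ^ 3 ≤ (∑ j ∈ s, E j) * (∑ j ∈ s, E j ^ 2) :=
    fun s => sum_cube_le_sum_mul_sum_sq s E (fun j _ => he j)
  have her1 : ∀ (i : Fin k) (n : ℕ), ∑ j ∈ Finset.univ.erase i, E j ^ n = (∑ j, E j ^ n) - E i ^ n :=
    fun i n => sum_erase_pow_eq E i n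
  have her2 : ∀ (i j : Fin k), j ≠ i → ∀ n : ℕ,
      ∑ l ∈ (Finset.univ.erase i).erase j, E l ^ n = (∑ l, E l ^ n) - E i ^ n - E j ^ n := by
    intro i j hji n
    rw [Finset.sum_erase_eq_sub (Finset.mem_erase.2 ⟨hji, Finset.mem_univ j⟩), her1 i n]
  have hP1' : ∑ j, E j ^ 1 = P1 := by rw [hP1]; exact Finset.sum_congr rfl (fun j _ => pow_one (E j))
  -- off-diagonal forms are nonnegative
  have hE : ∀ i j : Fin k, j ≠ i →
      0 ≤ A0 + A1 * (E i + E j) + A2 * (E i ^ 2 + E j ^ 2) + A11 * E i * E j := by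
    intro i j hji
    have h1 := her2 i j hji 1; have h2 := her2 i j hji 2; have h3 := her2 i j hji 3; have h4 := her2 i j hji 4
    rw [hP1'] at h1
    simp only [pow_one] at h1
    have q := hedge (E i) (E j) Om P1 P2 P3 P4 (he i) (he j) hΩ.le
      (by rw [← h1]; exact hpow _ 1 |>.trans_eq (Finset.sum_congr rfl (fun l _ => pow_one (E l))))
      (by rw [← h2]; exact hpow _ 2) (by rw [← h3]; exact hpow _ 3) (by rw [← h4]; exact hpow _ 4)
      (by rw [← h1, ← h2]; exact hsq _) (by rw [← h1, ← h2, ← h3]; exact hcu _)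
    rw [hA0, hA1, hA2, hA11]; exact q
  -- diagonal forms dominate 96 e⁸
  have hV : ∀ i : Fin k, 96 * E i ^ 8 ≤ A0 + 2 * A1 * E i + (2 * A2 + A11) * E i ^ 2 + 12 * (P1 ^ 2 + P2) * (Om + P1 ^ 2 + P2) ^ 3 := by
    intro i
    have h1 := her1 i 1; have h2 := her1 i 2; have h3 := her1 i 3; have h4 := her1 i 4
    rw [hP1'] at h1
    simp only [pow_one] at h1
    have q := vertexAgg_ge (E i) Om P1 P2 P3 P4 (he i) hΩ.le
      (by rw [← h1]; exact hpow _ 1 |>.trans_eq (Finset.sum_congr rfl (fun l _ => pow_one (E l))))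
      (by rw [← h2]; exact hpow _ 2) (by rw [← h3]; exact hpow _ 3) (by rw [← h4]; exact hpow _ 4)
      (by rw [← h1, ← h2]; exact hsq _) (by rw [← h1, ← h2, ← h3]; exact hcu _)
    rw [hA0, hA1, hA2, hA11]; exact q
  -- (I3) the double sum dominates its diagonal
  have hI3 : ∑ i, (ρ * (ρ - 1) * π i) ^ 2 * (A0 + 2 * A1 * E i + (2 * A2 + A11) * E i ^ 2)
      ≤ ∑ i, ∑ j, ρ * (ρ - 1) * π i * (ρ * (ρ - 1) * π j)
        * (A0 + A1 * (E i + E j) + A2 * (E i ^ 2 + E j ^ 2) + A11 * E i * E j) := by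
    apply Finset.sum_le_sum
    intro i _
    rw [← Finset.add_sum_erase _ _ (Finset.mem_univ i)]
    have hdiag : ρ * (ρ - 1) * π i * (ρ * (ρ - 1) * π i)
        * (A0 + A1 * (E i + E i) + A2 * (E i ^ 2 + E i ^ 2) + A11 * E i * E i)
        = (ρ * (ρ - 1) * π i) ^ 2 * (A0 + 2 * A1 * E i + (2 * A2 + A11) * E i ^ 2) := by ring
    rw [hdiag]
    have hrest : 0 ≤ ∑ j ∈ Finset.univ.erase i, ρ * (ρ - 1) * π i * (ρ * (ρ - 1) * π j)
        * (A0 + A1 * (E i + E j) + A2 * (E i ^ 2 + E j ^ 2) + A11 * E i * E j) :=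
      Finset.sum_nonneg (fun j hj => mul_nonneg (mul_nonneg (hy i) (hy j)) (hE i j (Finset.ne_of_mem_erase hj)))
    linarith
  -- (I4) the diagonal with the `12σ₂CAP³W₀` term dominates `96 Σ y_i² e_i⁸`
  have hI4 : ∑ i, (ρ * (ρ - 1) * π i) ^ 2 * (96 * E i ^ 8)
      ≤ ∑ i, (ρ * (ρ - 1) * π i) ^ 2 * (A0 + 2 * A1 * E i + (2 * A2 + A11) * E i ^ 2)
        + 12 * (P1 ^ 2 + P2) * Y0 ^ 3 * W0 := by
    have hW : 12 * (P1 ^ 2 + P2) * Y0 ^ 3 * W0 = ∑ i, (ρ * (ρ - 1) * π i) ^ 2 * (12 * (P1 ^ 2 + P2) * (Om + P1 ^ 2 + P2) ^ 3) := by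
      rw [hW0, Finset.mul_sum, hCAP]
      exact Finset.sum_congr rfl (fun i _ => by ring)
    rw [hW, ← Finset.sum_add_distrib]
    apply Finset.sum_le_sum
    intro i _
    have := hV i
    nlinarith [sq_nonneg (ρ * (ρ - 1) * π i)]
  -- (I5) some row carries excess variance and a positive mean
  have hI5 : 0 < ∑ i, (ρ * (ρ - 1) * π i) ^ 2 * (96 * E i ^ 8) := by
    by_contra hneg
    have hle : ∑ i, (ρ * (ρ - 1) * π i) ^ 2 * (96 * E i ^ 8) ≤ 0 := not_lt.mp hneg
    have hterm : ∀ i, 0 ≤ (ρ * (ρ - 1) * π i) ^ 2 * (96 * E i ^ 8) := fun i => by positivity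
    have hzero : ∀ i ∈ Finset.univ, (ρ * (ρ - 1) * π i) ^ 2 * (96 * E i ^ 8) = 0 :=
      (Finset.sum_eq_zero_iff_of_nonneg (fun i _ => hterm i)).1 (le_antisymm hle (Finset.sum_nonneg (fun i _ => hterm i)))
    -- every row has π i = 0: if π i > 0 then E i ≥ ρ π i > 0 and the term is positive
    have hπ0 : ∀ i, π i = 0 := by
      intro i
      by_contra hc
      obtain ⟨hπ, hα, _⟩ := hF i
      have hπpos : 0 < π i := lt_of_le_of_ne hπ (Ne.symm hc)
      have hEpos : 0 < E i := by nlinarith [mul_pos hρ0 hπpos]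
      have hypos : 0 < ρ * (ρ - 1) * π i := mul_pos (by nlinarith) hπpos
      have : 0 < (ρ * (ρ - 1) * π i) ^ 2 * (96 * E i ^ 8) := by positivity
      linarith [hzero i (Finset.mem_univ i)]
    have : Y0 = 0 := by rw [hY0]; exact Finset.sum_eq_zero (fun i _ => by rw [hπ0 i]; ring)
    linarith
  -- conclude: `Y0² G > 0`
  have hmain : 0 < Y0 ^ 2 * ((8 : ℝ) * P1 ^ 8 + (20 : ℝ) * P1 ^ 6 * Om + (32 : ℝ) * P1 ^ 6 * P2 + (8 : ℝ) * P1 ^ 7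
        + (16 : ℝ) * P1 ^ 4 * Om ^ 2 + (64 : ℝ) * P1 ^ 4 * P2 * Om + (24 : ℝ) * P1 ^ 4 * P2 ^ 2
        + (-16 : ℝ) * P1 ^ 5 * Y1 + (16 : ℝ) * P1 ^ 5 * Om + (32 : ℝ) * P1 ^ 5 * P3 + (16 : ℝ) * P1 ^ 5 * P2
        + (4 : ℝ) * P1 ^ 2 * Om ^ 3 + (40 : ℝ) * P1 ^ 2 * P2 * Om ^ 2 + (28 : ℝ) * P1 ^ 2 * P2 ^ 2 * Om
        + (-24 : ℝ) * P1 ^ 3 * Om * Y1 + (8 : ℝ) * P1 ^ 3 * Om ^ 2 + (48 : ℝ) * P1 ^ 3 * P3 * Om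
        + (-16 : ℝ) * P1 ^ 3 * P2 * Y1 + (24 : ℝ) * P1 ^ 3 * P2 * Om + (32 : ℝ) * P1 ^ 3 * P2 * P3
        + (8 : ℝ) * P1 ^ 3 * P2 ^ 2 + (12 : ℝ) * P1 ^ 4 * W0 + (-48 : ℝ) * P1 ^ 4 * Y2 + (12 : ℝ) * P1 ^ 4 * Y1
        + (24 : ℝ) * P1 ^ 4 * P4 + (-8 : ℝ) * P1 ^ 4 * P3 + (8 : ℝ) * P2 * Om ^ 3 + (8 : ℝ) * P2 ^ 2 * Om ^ 2
        + (-8 : ℝ) * P1 * Om ^ 2 * Y1 + (16 : ℝ) * P1 * P3 * Om ^ 2 + (-8 : ℝ) * P1 * P2 * Om * Y1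
        + (8 : ℝ) * P1 * P2 * Om ^ 2 + (16 : ℝ) * P1 * P2 * P3 * Om + (8 : ℝ) * P1 * P2 ^ 2 * Om
        + (12 : ℝ) * P1 ^ 2 * Y1 ^ 2 + (12 : ℝ) * P1 ^ 2 * Om * W0 + (-48 : ℝ) * P1 ^ 2 * Om * Y2
        + (12 : ℝ) * P1 ^ 2 * Om * Y1 + (24 : ℝ) * P1 ^ 2 * P4 * Om + (16 : ℝ) * P1 ^ 2 * P3 * Y1
        + (-8 : ℝ) * P1 ^ 2 * P3 * Om + (-16 : ℝ) * P1 ^ 2 * P3 ^ 2 + (24 : ℝ) * P1 ^ 2 * P2 * W0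
        + (-96 : ℝ) * P1 ^ 2 * P2 * Y2 + (24 : ℝ) * P1 ^ 2 * P2 * Y1 + (48 : ℝ) * P1 ^ 2 * P2 * P4
        + (-16 : ℝ) * P1 ^ 2 * P2 * P3 + (-4 : ℝ) * Om * Y1 ^ 2 + (16 : ℝ) * P3 * Om * Y1
        + (-16 : ℝ) * P3 ^ 2 * Om + (12 : ℝ) * P2 * Y1 ^ 2 + (12 : ℝ) * P2 * Om * W0 + (-48 : ℝ) * P2 * Om * Y2
        + (12 : ℝ) * P2 * Om * Y1 + (24 : ℝ) * P2 * P4 * Om + (16 : ℝ) * P2 * P3 * Y1 + (-8 : ℝ) * P2 * P3 * Om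
        + (-16 : ℝ) * P2 * P3 ^ 2 + (12 : ℝ) * P2 ^ 2 * W0 + (-48 : ℝ) * P2 ^ 2 * Y2 + (12 : ℝ) * P2 ^ 2 * Y1
        + (24 : ℝ) * P2 ^ 2 * P4 + (-8 : ℝ) * P2 ^ 2 * P3) := by
    rw [hI1, ← hI2]
    linarith [hI3, hI4, hI5]
  by_contra hneg
  have hG0 := not_lt.mp hneg
  have hprod := mul_nonneg (sq_nonneg Y0) (neg_nonneg.mpr hG0)
  linarith [hmain, hprod]

/-- **THEOREM E∞ modulo the edge transport (pen val-idea-25 g9 §56.24; crit-1 #430's CONJECTURE E) — ΩLC for EVERY `k`:** if the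
aggregate EDGE FORM is nonnegative under the power-sum hypotheses of the remaining rows (`hedge` — literally the statement of the pending
`edgeAgg_nonneg`, i.e. the landed `edgePoly_nonneg` (`…EdgeCert`) transported by `p_n = P_n − e₁ⁿ − e₂ⁿ`), then at every feasible state with
`Ω > 0` (`ρ > 1`), `Ω·Ω″ < Ω′²` for every number `k` of zero-change rows. -/
theorem OmegaLogConcave_of_edgeAgg
    (hedge : ∀ e1 e2 Om P1 P2 P3 P4 : ℝ, 0 ≤ e1 → 0 ≤ e2 → 0 ≤ Om → 0 ≤ P1 - e1 - e2 → 0 ≤ P2 - e1 ^ 2 - e2 ^ 2 →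
      0 ≤ P3 - e1 ^ 3 - e2 ^ 3 → 0 ≤ P4 - e1 ^ 4 - e2 ^ 4 → P2 - e1 ^ 2 - e2 ^ 2 ≤ (P1 - e1 - e2) ^ 2 →
      P3 - e1 ^ 3 - e2 ^ 3 ≤ (P1 - e1 - e2) * (P2 - e1 ^ 2 - e2 ^ 2) →
      0 ≤ ((8 : ℝ) * P1 ^ 8 + (32 : ℝ) * P1 ^ 6 * P2 + (8 : ℝ) * P1 ^ 7 + (20 : ℝ) * Om * P1 ^ 6
        + (24 : ℝ) * P1 ^ 4 * P2 ^ 2 + (32 : ℝ) * P1 ^ 5 * P3 + (16 : ℝ) * P1 ^ 5 * P2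
        + (64 : ℝ) * Om * P1 ^ 4 * P2 + (16 : ℝ) * Om * P1 ^ 5 + (16 : ℝ) * Om ^ 2 * P1 ^ 4
        + (32 : ℝ) * P1 ^ 3 * P2 * P3 + (8 : ℝ) * P1 ^ 3 * P2 ^ 2 + (24 : ℝ) * P1 ^ 4 * P4
        + (-8 : ℝ) * P1 ^ 4 * P3 + (28 : ℝ) * Om * P1 ^ 2 * P2 ^ 2 + (48 : ℝ) * Om * P1 ^ 3 * P3
        + (24 : ℝ) * Om * P1 ^ 3 * P2 + (40 : ℝ) * Om ^ 2 * P1 ^ 2 * P2 + (8 : ℝ) * Om ^ 2 * P1 ^ 3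
        + (4 : ℝ) * Om ^ 3 * P1 ^ 2 + (-16 : ℝ) * P1 ^ 2 * P3 ^ 2 + (48 : ℝ) * P1 ^ 2 * P2 * P4
        + (-16 : ℝ) * P1 ^ 2 * P2 * P3 + (16 : ℝ) * Om * P1 * P2 * P3 + (8 : ℝ) * Om * P1 * P2 ^ 2
        + (24 : ℝ) * Om * P1 ^ 2 * P4 + (-8 : ℝ) * Om * P1 ^ 2 * P3 + (8 : ℝ) * Om ^ 2 * P2 ^ 2
        + (16 : ℝ) * Om ^ 2 * P1 * P3 + (8 : ℝ) * Om ^ 2 * P1 * P2 + (8 : ℝ) * Om ^ 3 * P2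
        + (-16 : ℝ) * P2 * P3 ^ 2 + (24 : ℝ) * P2 ^ 2 * P4 + (-8 : ℝ) * P2 ^ 2 * P3 + (-16 : ℝ) * Om * P3 ^ 2
        + (24 : ℝ) * Om * P2 * P4 + (-8 : ℝ) * Om * P2 * P3)
      + ((-8 : ℝ) * P1 ^ 7 + (-16 : ℝ) * P1 ^ 5 * P2 + (6 : ℝ) * P1 ^ 6 + (-20 : ℝ) * Om * P1 ^ 5
        + (-8 : ℝ) * P1 ^ 3 * P2 ^ 2 + (8 : ℝ) * P1 ^ 4 * P3 + (18 : ℝ) * P1 ^ 4 * P2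
        + (-24 : ℝ) * Om * P1 ^ 3 * P2 + (12 : ℝ) * Om * P1 ^ 4 + (-16 : ℝ) * Om ^ 2 * P1 ^ 3
        + (16 : ℝ) * P1 ^ 2 * P2 * P3 + (18 : ℝ) * P1 ^ 2 * P2 ^ 2 + (-4 : ℝ) * Om * P1 * P2 ^ 2
        + (16 : ℝ) * Om * P1 ^ 2 * P3 + (24 : ℝ) * Om * P1 ^ 2 * P2 + (-8 : ℝ) * Om ^ 2 * P1 * P2
        + (6 : ℝ) * Om ^ 2 * P1 ^ 2 + (-4 : ℝ) * Om ^ 3 * P1 + (8 : ℝ) * P2 ^ 2 * P3 + (6 : ℝ) * P2 ^ 3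
        + (16 : ℝ) * Om * P2 * P3 + (12 : ℝ) * Om * P2 ^ 2 + (8 : ℝ) * Om ^ 2 * P3 + (6 : ℝ) * Om ^ 2 * P2) * (e1 + e2)
      + ((-24 : ℝ) * P1 ^ 6 + (-72 : ℝ) * P1 ^ 4 * P2 + (-48 : ℝ) * Om * P1 ^ 4 + (-72 : ℝ) * P1 ^ 2 * P2 ^ 2
        + (-96 : ℝ) * Om * P1 ^ 2 * P2 + (-24 : ℝ) * Om ^ 2 * P1 ^ 2 + (-24 : ℝ) * P2 ^ 3
        + (-48 : ℝ) * Om * P2 ^ 2 + (-24 : ℝ) * Om ^ 2 * P2) * (e1 ^ 2 + e2 ^ 2)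
      + ((12 : ℝ) * P1 ^ 6 + (36 : ℝ) * P1 ^ 4 * P2 + (20 : ℝ) * Om * P1 ^ 4 + (36 : ℝ) * P1 ^ 2 * P2 ^ 2
        + (40 : ℝ) * Om * P1 ^ 2 * P2 + (4 : ℝ) * Om ^ 2 * P1 ^ 2 + (12 : ℝ) * P2 ^ 3 + (20 : ℝ) * Om * P2 ^ 2
        + (4 : ℝ) * Om ^ 2 * P2 + (-4 : ℝ) * Om ^ 3) * e1 * e2)
    (k : ℕ) : OmegaLogConcave k :=
  OmegaLogConcave_of_GPos k (fun ρ E π hρ hF hΩ => G_pos_of_edge hedge k ρ E π hρ hF hΩ)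

end ZeroChangeState

end Summit.ValiantsHypothesis.ValiantsHypothesis.Theorems.LacunarySymmetroidMatrixDescartes
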